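import Literature.Probability.LatticeModels.GibbsExistenceCompact
import Literature.Probability.LatticeModels.ONModelDobrushinStates
import HarnessLib

/-!
# The O(N) model: existence of infinite-volume Gibbs measures, and uniqueness at high temperature

Sibling proof file of `Literature/Probability/LatticeModels/ONModel.lean` (the classical O(N) /
N-vector model on a locally finite graph; kernels `γ_Λ(· | η) = μ^η_{Λ;β}`,
`Literature.Probability.LatticeModels.onSpecification`). No definition and no named fact is
introduced (D-0026); everything here is proved.

* **Feller property** (`continuous_integral_onSpecification`): for bounded continuous `F`,
  `η ↦ ∫ F dγ_Λ(· | η)` is continuous — the Boltzmann weight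
  `w_Λ = exp (β ∑_{e ∈ ℰ^b_Λ} ⟪σ_a, σ_b⟫)` is a continuous function of finitely many spins and the
  fibre `(𝕊^{N-1})^Λ` is compact (Friedli–Velenik 2017, Def. 6.25 / Exercise 6.13 and §6.10.2:
  "the Feller property").
* **Existence** (`gibbsMeasures_onSpecification_nonempty`, `onGibbsMeasures_nonempty`): for every
  countable locally finite graph, every `N ≥ 1` and every `β`, `𝒢(γ^{O(N)}_β) ≠ ∅`, by the generic
  compactness theorem `IsSpecification.gibbsMeasures_nonempty_of_feller`
  (`GibbsExistenceCompact.lean`; Friedli–Velenik 2017, Thm. 6.26 with §6.10.2 for the compact spin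
  space `Ω₀ = 𝕊^{N-1}`).
* **Uniqueness at high temperature** (`hasUniqueGibbsMeasure_onSpecification`,
  `hasUniqueGibbsMeasure_onSpecification_zd`, `onGibbsMeasures_unique_high_temperature`):
  combined with Dobrushin's uniqueness theorem for the O(N) model already in the tree
  (`subsingleton_gibbsMeasures_onSpecification`, Friedli–Velenik 2017, Thm. 6.31 with the
  continuous-spin dusting estimate), `|𝒢(γ^{O(N)}_β)| = 1` whenever `D (e^{4|β|} - 1) < 1` for a
  degree bound `D`; on `ℤ^d` (`D = 2d`) this holds for `|β| < ¼ log (1 + 1/(2d+1))`. This is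
  conjunct (i) of the named fact
  `Literature.MathematicalPhysics.QuantumFieldTheory.onTwoPoint_decay_high_temperature`
  (`LatticeMassGap.lean`) with an explicit `β₀(d) = ¼ log (1 + 1/(2d+1))`; conjunct (ii)
  (exponential decay of `⟨s_0 · s_x⟩`) is not addressed in this file.

## References

* S. Friedli, Y. Velenik, *Statistical Mechanics of Lattice Systems*, CUP (2017) (held copy, read
  first-hand): §6.4.3 Def. 6.25 and Exercise 6.13 p. 284 (quasilocality / `π_Λ f ∈ C(Ω)`),
  Thm. 6.26 p. 284 (existence), Thm. 6.31 p. 287 (Dobrushin uniqueness), §6.10.2 p. 332 (compact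
  spin space: existence "by the compactness of `𝓜₁(Ω)` and the Feller property"), §9.1 (the O(N)
  model).
* H.-O. Georgii, *Gibbs Measures and Phase Transitions*, 2nd ed. (2011), Thm. 4.17, Thm. 8.7 with
  Prop. 8.8 (as cited by the sibling files; not re-read here).
-/

noncomputable section

open MeasureTheory Filter Topology TopologicalSpace Finset
open scoped ENNReal RealInnerProductSpace BoundedContinuousFunction

namespace Literature.Probability.LatticeModels

variable {V : Type*} {N : ℕ}

/-! ### General helpers -/

section Helpers

/-- Continuity of a parametric integral with a uniformly bounded, separately continuous integrand
over a finite measure (dominated convergence). [folklore] -/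
private theorem onFeller_continuous_integral_of_bound {X Y : Type*} [TopologicalSpace X]
    [FirstCountableTopology X] [TopologicalSpace Y] [MeasurableSpace Y] [OpensMeasurableSpace Y]
    {μ : Measure Y} [IsFiniteMeasure μ] {Φ : X → Y → ℝ} (h1 : ∀ x, Continuous (Φ x))
    (h2 : ∀ y, Continuous fun x => Φ x y) {C : ℝ} (hC : ∀ x y, |Φ x y| ≤ C) :
    Continuous fun x => ∫ y, Φ x y ∂μ :=
  continuous_of_dominated (fun x => (h1 x).aestronglyMeasurable)
    (fun x => ae_of_all _ fun y => by simpa [Real.norm_eq_abs] using hC x y)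
    (integrable_const C) (ae_of_all _ fun y => h2 y)

/-- A countable product of pseudo-metrisable spaces is first countable (via the `PiCountable`
distance, whose uniformity is the product uniformity by construction). [folklore] -/
private theorem firstCountableTopology_pi_countable {ι : Type*} [Countable ι] {A : ι → Type*}
    [∀ i, TopologicalSpace (A i)] [∀ i, PseudoMetrizableSpace (A i)] :
    FirstCountableTopology (∀ i, A i) := by
  letI : Encodable ι := Encodable.ofCountable ι
  letI : ∀ i, PseudoMetricSpace (A i) := fun i => pseudoMetrizableSpacePseudoMetric (A i)
  letI : PseudoMetricSpace (∀ i, A i) := PiCountable.pseudoMetricSpace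
  infer_instance

end Helpers

/-! ### Continuity of the O(N) Boltzmann weight and of the gluing map -/

section Continuity

variable (G : SimpleGraph V) [DecidableEq V] [G.LocallyFinite]

omit [DecidableEq V] [G.LocallyFinite] in
/-- The bond observable `s ↦ ⟪s_x, s_y⟫` is continuous (Friedli–Velenik 2017, §9.1 with §6.10.2:
continuous-spin interactions). [cite: FriedliVelenik2017, §9.1] -/
theorem continuous_onBond (e : Sym2 V) : Continuous fun s : ONConfig V N => onBond s e := by
  induction e using Sym2.ind with
  | _ x y =>
    simp only [onBond_mk]
    exact ((continuous_apply x).subtype_val).inner (continuous_apply y).subtype_val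

/-- The fixed-boundary Boltzmann weight `w_Λ = exp (β ∑_{e ∈ ℰ^b_Λ} ⟪σ_a, σ_b⟫)` is continuous
(Friedli–Velenik 2017, eq. (9.2) with §6.10.2). [cite: FriedliVelenik2017, eq. (9.2) with §6.10.2] -/
theorem continuous_onWeightR (Λ : Finset V) (β : ℝ) : Continuous (onWeightR (N := N) G Λ β) := by
  unfold onWeightR
  exact Real.continuous_exp.comp (continuous_const.mul
    (continuous_finsetSum _ fun e _ => continuous_onBond e))

omit [DecidableEq V] [G.LocallyFinite] in
/-- Gluing `ζ ↦ ζ η_{Λᶜ}` is continuous in the inner configuration (fixed boundary condition).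
[folklore] -/
private theorem continuous_onGlue_inner [NeZero N] (Λ : Finset V) (η : ONConfig V N) :
    Continuous fun ζ : ↥Λ → SphereSpin N => onGlue Λ ζ (.fixed η) := by
  refine continuous_pi fun x => ?_
  by_cases hx : x ∈ Λ
  · simp only [onGlue, ONBoundary.outside_fixed, glueWith_apply_mem _ _ _ hx]
    exact continuous_apply _
  · simp only [onGlue, ONBoundary.outside_fixed, glueWith_apply_not_mem _ _ _ hx]
    exact continuous_const

omit [DecidableEq V] [G.LocallyFinite] in
/-- Gluing `η ↦ ζ η_{Λᶜ}` is continuous in the boundary condition (fixed inner configuration).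
[folklore] -/
private theorem continuous_onGlue_outer [NeZero N] (Λ : Finset V) (ζ : ↥Λ → SphereSpin N) :
    Continuous fun η : ONConfig V N => onGlue Λ ζ (.fixed η) := by
  refine continuous_pi fun x => ?_
  by_cases hx : x ∈ Λ
  · simp only [onGlue, ONBoundary.outside_fixed, glueWith_apply_mem _ _ _ hx]
    exact continuous_const
  · simp only [onGlue, ONBoundary.outside_fixed, glueWith_apply_not_mem _ _ _ hx]
    exact continuous_apply x

variable [NeZero N] [Countable V]

/-- **Continuity in the boundary condition of the un-normalised kernel integrals**
`η ↦ ∫ w_Λ(ζ η_{Λᶜ}) F(ζ η_{Λᶜ}) dν^{⊗Λ}(ζ)` for bounded continuous `F`: the integrand is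
separately continuous and uniformly bounded, the fibre `(𝕊^{N-1})^Λ` carries a probability measure
(Friedli–Velenik 2017, §6.10.2, "the Feller property"). [cite: FriedliVelenik2017, §6.10.2] -/
theorem continuous_integral_onWeightR_onGlue (Λ : Finset V) (β : ℝ) {F : ONConfig V N → ℝ}
    (hF : Continuous F) {C : ℝ} (hC : ∀ σ, |F σ| ≤ C) :
    Continuous fun η : ONConfig V N =>
      ∫ ζ, onWeightR G Λ β (onGlue Λ ζ (.fixed η)) * F (onGlue Λ ζ (.fixed η))
        ∂(onReference N Λ) := by
  haveI : FirstCountableTopology (ONConfig V N) :=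
    firstCountableTopology_pi_countable (A := fun _ : V => SphereSpin N)
  have hwle : ∀ σ : ONConfig V N, |onWeightR G Λ β σ| ≤ Real.exp (|β| * #(edgesTouching G Λ)) :=
    fun σ => by
      rw [abs_of_pos (onWeightR_pos G Λ β σ)]
      exact onWeightR_le G Λ β σ
  have hw := continuous_onWeightR (N := N) G Λ β
  refine onFeller_continuous_integral_of_bound
    (Φ := fun (η : ONConfig V N) (ζ : ↥Λ → SphereSpin N) =>
      onWeightR G Λ β (onGlue Λ ζ (.fixed η)) * F (onGlue Λ ζ (.fixed η)))
    (fun η => (hw.comp (continuous_onGlue_inner Λ η)).mul (hF.comp (continuous_onGlue_inner Λ η)))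
    (fun ζ => (hw.comp (continuous_onGlue_outer Λ ζ)).mul (hF.comp (continuous_onGlue_outer Λ ζ)))
    (C := Real.exp (|β| * #(edgesTouching G Λ)) * C) fun η ζ => ?_
  rw [abs_mul]
  exact mul_le_mul (hwle _) (hC _) (abs_nonneg _)
    ((abs_nonneg _).trans (hwle (onGlue Λ ζ (.fixed η))))

/-- **Continuity of the partition function in the boundary condition**,
`η ↦ Z^η_Λ = ∫ w_Λ(ζ η_{Λᶜ}) dν^{⊗Λ}(ζ)` (Friedli–Velenik 2017, eq. (6.31) with §6.10.2).
[cite: FriedliVelenik2017, eq. (6.31) with §6.10.2] -/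
theorem continuous_onPartitionFunction_fixed (Λ : Finset V) (β : ℝ) :
    Continuous fun η : ONConfig V N => onPartitionFunction G Λ β (.fixed η) := by
  simp only [onPartitionFunction_fixed_eq]
  have h := continuous_integral_onWeightR_onGlue G Λ β (F := fun _ : ONConfig V N => (1 : ℝ))
    continuous_const (C := 1) (fun _ => by simp)
  simpa using h

/-- **Feller property of the O(N) specification**: for bounded continuous `F`, the map
`η ↦ ∫ F dγ_Λ(· | η)` is continuous; equivalently the kernels are quasilocal in the sense of
Friedli–Velenik 2017, Def. 6.25, and map `C(Ω)` to `C(Ω)` (Exercise 6.13; §6.10.2 for compact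
single-spin spaces). [cite: FriedliVelenik2017, Def. 6.25 / Exercise 6.13; §6.10.2] -/
theorem continuous_integral_onSpecification (β : ℝ) (Λ : Finset V) (F : ONConfig V N →ᵇ ℝ) :
    Continuous fun η => ∫ σ, F σ ∂(onSpecification G β Λ η) := by
  have hFb : ∀ σ, |F σ| ≤ ‖F‖ := fun σ => by
    simpa [Real.norm_eq_abs] using F.norm_coe_le_norm σ
  simp only [integral_onSpecification G β Λ _ F.continuous.measurable]
  refine (continuous_integral_onWeightR_onGlue G Λ β F.continuous hFb).div
    (continuous_onPartitionFunction_fixed G Λ β) fun η => (onPartitionFunction_pos G Λ β _).ne'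

end Continuity

/-! ### Existence of infinite-volume Gibbs measures -/

section Existence

variable (G : SimpleGraph V) [DecidableEq V] [G.LocallyFinite] [NeZero N] [Countable V]

/-- **Existence of infinite-volume Gibbs measures for the O(N) model**: on a countable locally
finite graph, for every `N ≥ 1` and every inverse temperature `β`, `𝒢(γ^{O(N)}_β) ≠ ∅`
(Friedli–Velenik 2017, Thm. 6.26 with §6.10.2 for the compact spin space `𝕊^{N-1}`: compactness
of `𝓜₁(Ω)` and the Feller property; Georgii 2011, Thm. 4.17).
[cite: FriedliVelenik2017, Thm. 6.26 with §6.10.2] -/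
theorem gibbsMeasures_onSpecification_nonempty (β : ℝ) :
    (gibbsMeasures (onSpecification (N := N) G β)).Nonempty := by
  haveI : Nonempty (SphereSpin N) := ⟨SphereSpin.north N⟩
  exact (isSpecification_onSpecification_countable G β).gibbsMeasures_nonempty_of_feller
    (continuous_integral_onSpecification G β)

omit G [DecidableEq V] [G.LocallyFinite] [Countable V] in
/-- **Existence on `ℤ^d`**: `onGibbsMeasures d N β ≠ ∅` for all `d`, `N ≥ 1`, `β`
(Friedli–Velenik 2017, Thm. 6.26 with §6.10.2 and §9.1). [cite: FriedliVelenik2017, Thm. 6.26 with §6.10.2] -/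
theorem onGibbsMeasures_nonempty (d : ℕ) (β : ℝ) : (onGibbsMeasures d N β).Nonempty :=
  gibbsMeasures_onSpecification_nonempty (zdGraph d) β

end Existence

/-! ### Uniqueness at high temperature -/

section HighTemperature

variable (G : SimpleGraph V) [DecidableEq V] [G.LocallyFinite] [DecidableRel G.Adj] [NeZero N]
  [Countable V]

/-- **Exactly one Gibbs measure in Dobrushin's regime**: on a countable locally finite graph with
degrees `≤ D`, if `D (e^{4|β|} - 1) < 1` then `|𝒢(γ^{O(N)}_β)| = 1` — existence by compactness
(Thm. 6.26 / §6.10.2) and uniqueness by Dobrushin's criterion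
(`subsingleton_gibbsMeasures_onSpecification`; Friedli–Velenik 2017, Thm. 6.31 with the O(N)
dusting estimate; Georgii 2011, Thm. 8.7 with Prop. 8.8).
[cite: FriedliVelenik2017, Thm. 6.31 with Thm. 6.26] -/
theorem hasUniqueGibbsMeasure_onSpecification (β : ℝ) {D : ℕ} (hdeg : ∀ x, G.degree x ≤ D)
    (hβ : D * onDobrushinCoeff β < 1) : HasUniqueGibbsMeasure (onSpecification (N := N) G β) :=
  ⟨subsingleton_gibbsMeasures_onSpecification G β hdeg hβ,
    gibbsMeasures_onSpecification_nonempty G β⟩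

omit G [DecidableEq V] [G.LocallyFinite] [DecidableRel G.Adj] [Countable V] in
/-- **High-temperature uniqueness on `ℤ^d`**: if `2d (e^{4|β|} - 1) < 1` then the O(N) model on
`ℤ^d` at inverse temperature `β` has exactly one infinite-volume Gibbs measure
(Friedli–Velenik 2017, Thm. 6.31 with Thm. 6.26, §6.10.2, §9.1; degrees of `ℤ^d` are `2d`).
[cite: FriedliVelenik2017, Thm. 6.31 with Thm. 6.26] -/
theorem hasUniqueGibbsMeasure_onSpecification_zd (d : ℕ) {β : ℝ}
    (hβ : (2 * d : ℕ) * onDobrushinCoeff β < 1) :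
    HasUniqueGibbsMeasure (onSpecification (N := N) (zdGraph d) β) :=
  hasUniqueGibbsMeasure_onSpecification (zdGraph d) β
    (fun x => ((SimpleGraph.card_neighborFinset_eq_degree _ x).symm.trans_le
      (card_neighborFinset_zdGraph_holds x).le)) hβ

omit G [DecidableEq V] [G.LocallyFinite] [DecidableRel G.Adj] [NeZero N] [Countable V] in
/-- **The explicit high-temperature window**: with `β₀(d) = ¼ log (1 + 1/(2d+1)) > 0`, every `β`
with `|β| < β₀(d)` satisfies Dobrushin's condition on `ℤ^d`, `2d (e^{4|β|} - 1) < 1` — indeed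
`2d (e^{4|β|} - 1) < 2d/(2d+1) ≤ 1` (Friedli–Velenik 2017, Example 6.36-type bookkeeping for the
row sums `2d · C(β)`). [cite: FriedliVelenik2017, Example 6.36] -/
theorem two_d_mul_onDobrushinCoeff_lt_one (d : ℕ) {β : ℝ}
    (hβ : |β| < Real.log (1 + 1 / (2 * d + 1)) / 4) :
    ((2 * d : ℕ) : ℝ) * onDobrushinCoeff β < 1 := by
  have hd : (0 : ℝ) < 2 * d + 1 := by positivity
  have h4 : 4 * |β| < Real.log (1 + 1 / (2 * d + 1)) := by linarith
  have hexp : Real.exp (4 * |β|) < 1 + 1 / (2 * d + 1) := by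
    calc Real.exp (4 * |β|) < Real.exp (Real.log (1 + 1 / (2 * d + 1))) := Real.exp_lt_exp.2 h4
      _ = 1 + 1 / (2 * d + 1) := Real.exp_log (by positivity)
  have hC : onDobrushinCoeff β < 1 / (2 * d + 1) := by
    unfold onDobrushinCoeff; linarith
  have hC0 : 0 ≤ onDobrushinCoeff β := onDobrushinCoeff_nonneg β
  have hcast : ((2 * d : ℕ) : ℝ) = 2 * d := by push_cast; ring
  rw [hcast]
  calc (2 * d : ℝ) * onDobrushinCoeff β ≤ (2 * d + 1) * onDobrushinCoeff β :=
        mul_le_mul_of_nonneg_right (by linarith) hC0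
    _ < (2 * d + 1) * (1 / (2 * d + 1)) := mul_lt_mul_of_pos_left hC hd
    _ = 1 := by field_simp

omit G [DecidableEq V] [G.LocallyFinite] [DecidableRel G.Adj] [NeZero N] [Countable V] in
/-- The high-temperature threshold `β₀(d) = ¼ log (1 + 1/(2d+1))` is positive. [folklore] -/
private theorem betaZero_pos (d : ℕ) : 0 < Real.log (1 + 1 / (2 * (d : ℝ) + 1)) / 4 := by
  have hd : (0 : ℝ) < 2 * d + 1 := by positivity
  have : (1 : ℝ) < 1 + 1 / (2 * d + 1) := by
    have := one_div_pos.2 hd; linarith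
  have := Real.log_pos this
  linarith

omit G [DecidableEq V] [G.LocallyFinite] [DecidableRel G.Adj] [Countable V] in
/-- **An explicit high-temperature window on `ℤ^d`**: with `β₀(d) = ¼ log (1 + 1/(2d+1)) > 0`, for
every `β` with `|β| < β₀(d)` the O(N) model on `ℤ^d` has exactly one Gibbs measure. This is
conjunct (i) of `Literature.MathematicalPhysics.QuantumFieldTheory.onTwoPoint_decay_high_temperature`
with an explicit threshold (Friedli–Velenik 2017, Thm. 6.31 with Example 6.36-type bookkeeping,
Thm. 6.26, §6.10.2). [cite: FriedliVelenik2017, Thm. 6.31 with Thm. 6.26] -/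
theorem onGibbsMeasures_unique_high_temperature (d : ℕ) {β : ℝ}
    (hβ : |β| < Real.log (1 + 1 / (2 * d + 1)) / 4) :
    HasUniqueGibbsMeasure (onSpecification (N := N) (zdGraph d) β) :=
  hasUniqueGibbsMeasure_onSpecification_zd d (two_d_mul_onDobrushinCoeff_lt_one d hβ)

omit G [DecidableEq V] [G.LocallyFinite] [DecidableRel G.Adj] [Countable V] in
/-- **High-temperature uniqueness on `ℤ^d`, existential form**: for every `d` and `N ≥ 1` there is
`β₀ > 0` (namely `¼ log (1 + 1/(2d+1))`) such that the O(N) model on `ℤ^d` has exactly one Gibbs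
measure for all `0 < β < β₀` (Friedli–Velenik 2017, Thm. 6.31 with Thm. 6.26 and §6.10.2;
Georgii 2011, Thm. 8.7 with Prop. 8.8). [cite: FriedliVelenik2017, Thm. 6.31 with Thm. 6.26] -/
theorem exists_hasUniqueGibbsMeasure_onSpecification_zd (d : ℕ) :
    ∃ β₀ > 0, ∀ β ∈ Set.Ioo 0 β₀, HasUniqueGibbsMeasure (onSpecification (N := N) (zdGraph d) β) := by
  refine ⟨Real.log (1 + 1 / (2 * (d : ℝ) + 1)) / 4, betaZero_pos d, fun β hβ => ?_⟩
  refine onGibbsMeasures_unique_high_temperature d ?_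
  rw [abs_of_pos hβ.1]
  exact hβ.2

end HighTemperature

end Literature.Probability.LatticeModels
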